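import Literature.NumberTheory.EllipticCurves.TakahashiDegreeFormulaCoprimeProofs
import Literature.NumberTheory.Automorphic.BrandtXiSetupIndependence
import Summits.ABC.ABC.Theses.DefiniteXi
import HarnessLib

/-!
# STUB-IDEAS companion — `stub_xiDegreeComparison` · ideator k1 · generation 31 (FAMILY 1: recognise & import)

Crux `stmt-ABC-15024` (`Summit.ABC.ABC.Theses.DefiniteXi.SteinbergCore`), line `p6_tamagawa_split`,
registered stub `stub_xiDegreeComparison` (child 1: `ξ ≠ 0 → ∃ D deg-minimal ∧ cps ξ ≤ C_ε N^ε·cps(deg D)·T³`).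

RECOGNISE: the stub's own guard `brandtXi (N/q) q (a(E)) ≠ 0` — UNUSED (`_hξ`) in the landed prime-type
closer `Summit.ABC.ABC.Theorems.xiDegreeComparison_prime_of_facts` (p137891) and in its item rewiring
`XiDegreeComparisonItems.xiDegreeComparison_prime_of_items` (p162272) — is precisely conjunct (M5)
"the `a(E)`-eigen-lattice of the Brandt matrices is a line" of the tree's split of Takahashi 2001 Thm. 2.3
(`takahashi2001_thm_2_3_of_coprime_of_brandtDictionary_one'`: dictionary (M1)–(M4) ∧ rank one (M5)),
because `Brandt.xi` is DEFINED as `0` off a line (`Brandt.xi_of_not_isLine`).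
IMPORT: the PROVED pointwise engine `Takahashi2001.exists_ij_of_brandtData` then yields Takahashi's
conclusion ON THE LOCUS `ξ_S ≠ 0` from the geometric dictionary ALONE (H-D2, proved below), so the
prime-type child closes modulo {`characterGroupDictionary_of_coprime` (D = 1, `r ∥ N`, NO multiplicity one),
`MazurKenkuBound`, `IsogenyValuationTransport`, `FreyModularity`} (H-D3, one prover cycle: p137891's proof
with the single `hT` call moved after `hL` and fed `_hξ`).  Elaboration sanity only; `sorry` only in H-D3/H-D3'.
[cite: Takahashi2001, §2 p. 78, Thm. 2.3 (p. 79), remark p. 80] [cite: ConradStein2001, §2.1, §7.1]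
[cite: Ribet1990, §3] [cite: PollackWeston2011, §2.1]
-/

set_option linter.dupNamespace false

noncomputable section

namespace Summit.ABC.ABC.Cruxes.SteinbergCore.StubIdeasK1G31

open scoped BigOperators
open Literature.NumberTheory.EllipticCurves Literature.NumberTheory.EllipticCurves.ModularForms
open Literature.NumberTheory.Automorphic

/-- **H-D0** (named-fact candidate; body VERBATIM the sibling seat's
`Cruxes/DefiniteRTControlPrime/StubIdeas1G25TakahashiSketch.lean :: takahashi2001_characterGroupDictionary_of_coprime`,
= hypothesis `H` of `takahashi2001_thm_2_3_of_coprime_of_brandtDictionary_one'` MINUS its `finrank = 1`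
conjunct and with the setup universally quantified): the character-group dictionary at `r ∥ N`, `D = 1`
— `X_r(J₀(Mr))` with Grothendieck's pairing inside the weighted Brandt lattice, `π_* π^* = δ`, `π_*` onto,
`X` saturated, `π^* 1` in the `a(W)`-eigen-lattice.  NO multiplicity-one / Jacquet–Langlands content.
[cite: ConradStein2001, §2.1, §7.1] [cite: Ribet1990, §3] [cite: Takahashi2001, Prop. 1.1, p. 80] -/
def characterGroupDictionary_of_coprime : Prop :=
  ∀ (W : WeierstrassCurve ℚ) [W.IsElliptic] (M r : ℕ) [NeZero (M * r)],
    r.Prime → M.Coprime r → W.conductorNorm ℤ = M * r →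
    ∀ P : ModularParametrizationData W (M * r),
      (∀ (W' : WeierstrassCurve ℚ) [W'.IsElliptic], W'.conductorNorm ℤ = M * r →
          ∀ P' : ModularParametrizationData W' (M * r),
          P'.f = P.f → P.modularDegree ≤ P'.modularDegree) →
      ∀ (S : Brandt.XiSetup M r) [Fintype (Brandt.ClassSet S.O)],
        ∃ (X : Submodule ℤ (Brandt.ClassSet S.O → ℤ)) (pb : ℤ →ₗ[ℤ] X) (pf : X →ₗ[ℤ] ℤ),
          (∀ (a : ℤ) (y : X),
              ∑ i, (Brandt.weight S.O i : ℤ) * (pb a : Brandt.ClassSet S.O → ℤ) i *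
                  (y : Brandt.ClassSet S.O → ℤ) i =
                ((W.minimalDiscriminantNorm ℤ).factorization r : ℤ) * a * pf y) ∧
          (∀ a : ℤ, pf (pb a) = (P.modularDegree : ℤ) * a) ∧
          Function.Surjective pf ∧
          (∀ (m : ℤ) (v : Brandt.ClassSet S.O → ℤ), m ≠ 0 → m • v ∈ X → v ∈ X) ∧
          (pb 1 : Brandt.ClassSet S.O → ℤ) ∈
            Brandt.eigenLattice (M * r) (Brandt.matrix S.O) (fun n => W.LFunction n)

/-- **H-D1′** (the weakened fact the stub actually consumes): Takahashi 2001 Thm. 2.3 at `r ∥ N`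
ON THE LOCUS `ξ_S(a(W)) ≠ 0` — `takahashi2001_thm_2_3_of_coprime` with one extra premise.
[cite: Takahashi2001, Thm. 2.3 (p. 79)] -/
def takahashi2001_thm_2_3_of_coprime_onXiLocus : Prop :=
  ∀ (W : WeierstrassCurve ℚ) [W.IsElliptic] (M r : ℕ) [NeZero (M * r)],
    r.Prime → M.Coprime r → W.conductorNorm ℤ = M * r →
    ∀ P : ModularParametrizationData W (M * r),
      (∀ (W' : WeierstrassCurve ℚ) [W'.IsElliptic], W'.conductorNorm ℤ = M * r →
          ∀ P' : ModularParametrizationData W' (M * r),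
          P'.f = P.f → P.modularDegree ≤ P'.modularDegree) →
      ∀ S : Brandt.XiSetup M r,
        S.xi (fun n => W.LFunction n) ≠ 0 →
        ∃ i j : ℕ, 0 < i ∧ i * j = (W.minimalDiscriminantNorm ℤ).factorization r ∧
          i ∣ S.xi (fun n => W.LFunction n) ∧
          P.modularDegree * i = S.xi (fun n => W.LFunction n) * j

/-- **H-D1** (XS, PROVED): `ξ_S(λ) ≠ 0` ⇒ the `λ`-eigen-lattice of the Brandt matrices of `S` is a
line `ℤ φ`, `φ ≠ 0` — `Brandt.xi` is the junk value `0` off a line (`Brandt.xi_of_not_isLine`).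
This is (M5) of Takahashi p. 78 read off the stub's guard. [cite: PollackWeston2011, §2.1] -/
theorem isLine_of_xi_ne_zero {M r : ℕ} (S : Brandt.XiSetup M r) [Fintype (Brandt.ClassSet S.O)]
    (lam : ℕ → ℤ) (h : S.xi lam ≠ 0) :
    ∃ φ : Brandt.ClassSet S.O → ℤ, φ ≠ 0 ∧
      Brandt.eigenLattice (M * r) (Brandt.matrix S.O) lam = ℤ ∙ φ := by
  by_contra hne
  apply h
  show Brandt.xiOfOrder S.O (M * r) lam = 0
  rw [Brandt.xiOfOrder_eq]
  exact Brandt.xi_of_not_isLine _ hne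

/-- **H-D1 (rank form)** (XS, PROVED): `ξ_S(λ) ≠ 0` ⇒ `finrank ℤ L(λ) = 1` — the `hrank` input of
`Takahashi2001.exists_ij_of_brandtData'`. [cite: Takahashi2001, §2 p. 78] -/
theorem finrank_eigenLattice_eq_one_of_xi_ne_zero {M r : ℕ} (S : Brandt.XiSetup M r)
    [Fintype (Brandt.ClassSet S.O)] (lam : ℕ → ℤ) (h : S.xi lam ≠ 0) :
    Module.finrank ℤ (Brandt.eigenLattice (M * r) (Brandt.matrix S.O) lam) = 1 := by
  obtain ⟨φ, hφ, hL⟩ := isLine_of_xi_ne_zero S lam h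
  rw [hL, ← (LinearEquiv.toSpanNonzeroSingleton ℤ (Brandt.ClassSet S.O → ℤ) φ hφ).finrank_eq,
    Module.finrank_self]

/-- **H-D2** (S, PROVED): the dictionary ALONE gives Takahashi's conclusion on the locus `ξ_S ≠ 0`
(`Takahashi2001.exists_ij_of_brandtData` with the generator produced by H-D1 and put in `X` by
saturation, exactly as in `Takahashi2001.exists_ij_of_brandtData'`). [cite: Takahashi2001, Thm. 2.3 and proof of Thm. 3.8 (p. 84)] -/
theorem onXiLocus_of_dictionary (H : characterGroupDictionary_of_coprime) :
    takahashi2001_thm_2_3_of_coprime_onXiLocus := by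
  intro W _ M r _ hr hcop hN P hmin S hξ
  classical
  letI : Fintype (Brandt.ClassSet S.O) := Fintype.ofFinite _
  obtain ⟨X, pb, pf, hadj, hδ, hsurj, hXsat, hmem⟩ := H W M r hr hcop hN P hmin S
  obtain ⟨g₀, hg₀, hL⟩ := isLine_of_xi_ne_zero S _ hξ
  rw [hL] at hmem
  obtain ⟨j, hj⟩ := Submodule.mem_span_singleton.mp hmem
  have hj0 : j ≠ 0 := by
    rintro rfl
    have h0 : pb 1 = 0 := Subtype.ext (by rw [← hj, zero_smul]; rfl)
    have h1 := hδ 1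
    rw [h0, map_zero, mul_one] at h1
    exact P.deg_pos.ne' (by exact_mod_cast h1.symm)
  have hg₀X : g₀ ∈ X := hXsat j g₀ hj0 (by rw [hj]; exact (pb 1).2)
  refine Takahashi2001.exists_ij_of_brandtData W M r hr hN P S X pb pf ⟨g₀, hg₀X⟩ j hadj hδ hsurj
    (Subtype.ext ?_) hL
  rw [← hj]
  rfl

/-- (XS, PROVED) The named fact implies its restriction to the locus — so every existing consumer
(p137891 / p162272 / A★) loses nothing by switching to H-D1′. [folklore] -/
theorem onXiLocus_of_fact (h : takahashi2001_thm_2_3_of_coprime) :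
    takahashi2001_thm_2_3_of_coprime_onXiLocus :=
  fun W _ M r _ hr hcop hN P hmin S _ => h W M r hr hcop hN P hmin S

/-- The PRIME-TYPE form of the stub (conclusion of `xiDegreeComparison_prime_of_facts`, p137891,
VERBATIM). [cite: Takahashi2001, Thm. 2.3] [cite: PastenShimura2024, §3 p. 13, Lemma 6.8] -/
def PrimeTypeComparison : Prop :=
    ∀ ε : ℝ, 0 < ε → ∃ C : ℝ, ∀ a b : ℤ, IsCoprime a b → a * b * (a + b) ≠ 0 → ∀ (N : ℕ) [NeZero N],
      (Literature.NumberTheory.EllipticCurves.freyCurve a b).conductorNorm ℤ = N →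
      ∀ q : ℕ, q.Prime → q ≠ 2 → q ∣ N →
      Literature.NumberTheory.Automorphic.brandtXi (N / q) q
          (fun n => (Literature.NumberTheory.EllipticCurves.freyCurve a b).LFunction n) ≠ 0 →
      ∃ D : Literature.NumberTheory.EllipticCurves.ModularForms.ModularParametrizationData
        (Literature.NumberTheory.EllipticCurves.freyCurve a b) N,
        (∀ D' : Literature.NumberTheory.EllipticCurves.ModularForms.ModularParametrizationData
          (Literature.NumberTheory.EllipticCurves.freyCurve a b) N, D.deg ≤ D'.deg) ∧
        ((Literature.NumberTheory.Automorphic.brandtXi (N / q) q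
              (fun n => (Literature.NumberTheory.EllipticCurves.freyCurve a b).LFunction n) /
            (ordProj[2] (Literature.NumberTheory.Automorphic.brandtXi (N / q) q
                (fun n => (Literature.NumberTheory.EllipticCurves.freyCurve a b).LFunction n)) *
              ordProj[3] (Literature.NumberTheory.Automorphic.brandtXi (N / q) q
                (fun n => (Literature.NumberTheory.EllipticCurves.freyCurve a b).LFunction n))) : ℕ) : ℝ) ≤
          C * (N : ℝ) ^ ε * ((D.deg / (ordProj[2] D.deg * ordProj[3] D.deg) : ℕ) : ℝ) *
            ((∏ p ∈ N.primeFactors, ((Literature.NumberTheory.EllipticCurves.freyCurve a b).minimalDiscriminantNorm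
              ℤ).factorization p : ℕ) : ℝ) ^ 3

/-- **The seam the prover edits** (XS, PROVED): from the stub's guard at type `(N/q, q)` to the premise of
H-D1′ at the conductor-restricted optimal pivot `W⋆` (`a(W⋆) = a(E)`), in ANY setup `S`. [folklore] -/
theorem xi_pivot_ne_zero {M q : ℕ} (S : Brandt.XiSetup M q) {lamE lamW : ℕ → ℤ}
    (hL : lamW = lamE) (hξ : brandtXi M q lamE ≠ 0) : S.xi lamW ≠ 0 := by
  rw [hL, ← Brandt.XiSetup.brandtXi_eq_xi S]
  exact hξ

/-- **H-D3** (M, ONE prover cycle; NOT proved here): the prime-type child from Takahashi ON THE LOCUS +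
the three route items.  Proof = `XiDegreeComparisonItems.xiDegreeComparison_prime_of_items` (p162272) /
`xiDegreeComparison_prime_of_facts` (p137891) verbatim, with the lines `hL` (`a(W⋆) = a(E)`) and `hdiv`
moved BEFORE the single call `hT Ws M q hq hcop hNs Ps hPsmin S`, which becomes
`hT Ws M q hq hcop hNs Ps hPsmin S (xi_pivot_ne_zero S hL (hdiv ▸ _hξ))`.
[cite: Takahashi2001, Thm. 2.3 (p. 79), remark p. 80] [cite: PastenShimura2024, §3 p. 13, Lemma 6.8] -/
theorem xiDegreeComparison_prime_of_onXiLocus :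
    takahashi2001_thm_2_3_of_coprime_onXiLocus →
    Summit.ABC.ABC.Theses.DefiniteXi.MazurKenkuBound →
    Summit.ABC.ABC.Theses.DefiniteXi.IsogenyValuationTransport →
    Summit.ABC.ABC.Theses.DefiniteXi.FreyModularity → PrimeTypeComparison := by
  sorry

/-- **H-D3′** (XS once H-D3 lands): the prime-type child modulo the GEOMETRIC dictionary and the three
route items — trust base of p162272 with `takahashi2001_thm_2_3_of_coprime` (which bundles Jacquet–Langlands
multiplicity one at the non-square-free level `M = 2^k·odd`, cf. `takahashi2001_thm_2_3_of_coprime.brandtXi_pos`)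
replaced by its dictionary half. [cite: Takahashi2001, Thm. 2.3] [cite: ConradStein2001, §7.1] -/
theorem xiDegreeComparison_prime_of_dictionary (hD : characterGroupDictionary_of_coprime)
    (hMK : Summit.ABC.ABC.Theses.DefiniteXi.MazurKenkuBound)
    (hIVT : Summit.ABC.ABC.Theses.DefiniteXi.IsogenyValuationTransport)
    (hMod : Summit.ABC.ABC.Theses.DefiniteXi.FreyModularity) : PrimeTypeComparison :=
  xiDegreeComparison_prime_of_onXiLocus (onXiLocus_of_dictionary hD) hMK hIVT hMod

end Summit.ABC.ABC.Cruxes.SteinbergCore.StubIdeasK1G31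

end
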